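import Literature.Probability.Percolation.LoopTraversalBound
import Literature.Probability.Percolation.InterfaceScalingLimitTriProofs
import Literature.Probability.RandomPlanarGeometry.CurveSystemTightness
import HarnessLib

/-!
# Tightness of the critical site-percolation loop ensemble: discharge of `isTightLaws_map_triLoopCollection`

Topic `Literature/Probability/Percolation`, companion to `CLE6.lean`. This file PROVES the named
fact `Literature.Probability.Percolation.isTightLaws_map_triLoopCollection` of `CLE6.lean`
(`isTightLaws_map_triLoopCollection_holds`): for every Jordan domain `D`, the laws of the closed
sets `triLoopCollection D δ` of interface loops of critical site percolation on `δ𝕋` in `D` with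
closed boundary condition, `δ ∈ (0, 1]`, form a tight family of Borel measures on the
Aizenman–Burchard space `LoopSpace ℂ` — M. Aizenman, A. Burchard, *Hölder regularity and dimension
bounds for random curves*, Duke Math. J. 99 (1999), Thm 1.2, whose hypothesis H1 holds for
critical percolation by RSW and the BK inequality (AB99, App. A); the first step of the
Camia–Newman proof of the full scaling limit (MSRI Publ. 55 (2008), §5).

The proof assembles the pieces proved in the tree:

* the Aizenman–Burchard criterion for random closed sets of curves,
  `LoopSpace.isTightLaws_map_of_traversalBounds` (`CurveSystemTightness.lean`, AB99 Thm 1.2 with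
  Lemma 3.1 and Lemma 4.2), applied with `Λ = closedBall 0 r₀` (`d = 2`,
  `exists_finset_card_le_cover_closedBall`), the random sets `X_δ(ω)` of interface polygons
  `hexLoopCurve δ w` of the restricted configuration `ω ∩ triMeshVertices D δ`, and
  `L_δ = triLoopCollection D δ` (the closure of their classes, so `L_δ ⊆ closure (mk '' X_δ)`);
* (H0), the short-distance cutoff, proved here: every interface polygon lies in `closedBall 0 r₀`
  and traverses no shell of inner radius `ρ ≤ δ` more than `k₀` times
  (`not_hasTraversals_toCurve_of_isCycle`, the cycle version of the tree's
  `not_hasTraversals_toCurve_of_isPath`: no dart of a cycle is repeated, and boundedly many darts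
  live near a small ball);
* (H1), the multiple-traversal estimate `triSitePercolation_exists_loop_hasTraversals_le`
  (`LoopTraversalBound.lean`: disjoint strict crossings, the three-arcs lemma, `j` disjoint open
  arms, BK and the annulus bound).

## References

* M. Aizenman, A. Burchard, Duke Math. J. 99 (1999), Thm 1.2, §1.a, Appendix A
  [AizenmanBurchardDuke1999].
* F. Camia, C. M. Newman, MSRI Publ. 55 (2008), §5 [CamiaNewman2008].
-/

noncomputable section

open Set Metric MeasureTheory Filter
open Literature.Probability.RandomPlanarGeometry

namespace Literature.Probability.Percolation

open LatticeModels

/-! ### (H0): the short-distance cutoff for interface loops -/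

/-- A `zip` whose right list has no duplicates has no duplicates. [folklore] -/
private theorem nodup_zip_of_nodup_right {α β : Type*} :
    ∀ {l₁ : List α} {l₂ : List β}, l₂.Nodup → (l₁.zip l₂).Nodup
  | [], _, _ => by simp
  | _ :: _, [], _ => by simp
  | a :: l₁, b :: l₂, h => by
    rw [List.nodup_cons] at h
    rw [List.zip_cons_cons, List.nodup_cons]
    exact ⟨fun hmem ↦ h.1 (List.of_mem_zip hmem).2, nodup_zip_of_nodup_right h.2⟩

/-- **No cycle of the hexagonal lattice traverses a shell many times near a controlled set of
darts** (cycle version of `not_hasTraversals_toCurve_of_isPath`): if every dart of the cycle `w`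
whose embedded segment meets `B̄(x, ρ)` belongs to the finite set `S`, the polygon of `w` does
not traverse `D(x; ρ, R)` `2 (#S + 1) + 1` times (the consecutive pairs of the support of a cycle
are pairwise distinct, as the tail of the support is). (AB99 §1.a "short-distance cutoff".)
[cite: AizenmanBurchardDuke1999, §1.a] -/
theorem not_hasTraversals_toCurve_of_isCycle {f : HexVertex} {w : hexGraph.Walk f f}
    (hw : w.IsCycle) (emb : HexVertex → ℂ) {x : ℂ} {ρ R : ℝ} (hρR : ρ < R)
    (S : Finset (HexVertex × HexVertex))
    (hS : ∀ d ∈ w.darts, (segment ℝ (emb d.fst) (emb d.snd) ∩ closedBall x ρ).Nonempty →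
      (d.fst, d.snd) ∈ S) :
    ¬ (⟨w.toCurve emb⟩ : Curve ℂ).HasTraversals (2 * (S.card + 1) + 1) x ρ R := by
  classical
  intro htr
  obtain ⟨l, hl⟩ : ∃ l, w.support = f :: l := ⟨w.support.tail, w.cons_tail_support.symm⟩
  have hfun : ∀ t, (⟨w.toCurve emb⟩ : Curve ℂ) t = (polylineFrom (emb f) (l.map emb)).2 t := by
    intro t
    change polyline (w.support.map emb) t = _
    rw [hl]
    rfl
  have hcov := hasOrdConnectedCover_preimage_polylineFrom (convex_closedBall x ρ) (emb f) (l.map emb)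
  have hpre : (⟨w.toCurve emb⟩ : Curve ℂ) ⁻¹' closedBall x ρ =
      (polylineFrom (emb f) (l.map emb)).2 ⁻¹' closedBall x ρ := by
    ext t
    rw [mem_preimage, mem_preimage, hfun]
  rw [← hpre] at hcov
  have htail : l.Nodup := by
    have := hw.support_nodup
    rw [hl] at this
    exact this
  have hnd : ((f :: l).zip l).Nodup := nodup_zip_of_nodup_right htail
  have hcount : segMeetCount (closedBall x ρ) (emb f) (l.map emb) ≤ S.card := by
    refine segMeetCount_map_le_card (closedBall x ρ) emb f l S hnd fun p hp hmeet ↦ ?_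
    have hp' : p ∈ w.support.zip w.support.tail := by rw [hl]; exact hp
    obtain ⟨d, hd, h1, h2⟩ := w.exists_dart_of_mem_zip_support hp'
    have hpd : p = (d.fst, d.snd) := Prod.ext h1.symm h2.symm
    rw [hpd] at hmeet ⊢
    exact hS d hd hmeet
  have hle := le_of_hasTraversals_of_hasOrdConnectedCover hρR (hcov.mono (Nat.add_le_add_right hcount 1)) htr
  omega

/-- **The two faces of an interface dart are close to an open site of the restriction**: for a
dart of an interface loop of `ω ∩ M`, the tail `v` of the crossed dart of `𝕋` lies in `M`, and both
face centres at mesh `δ` are within `δ` of the mesh point of `v` (within `1` in lattice units).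
[cite: CamiaNewman2006, §4] -/
theorem IsSiteInterfaceLoop.exists_near_of_mem_darts {ω M : Set (Site 2)} {f₀ : HexVertex} {w : hexGraph.Walk f₀ f₀}
    (hw : IsSiteInterfaceLoop (ω ∩ M) w) {δ : ℝ} (hδ : 0 ≤ δ) {d : hexGraph.Dart} (hd : d ∈ w.darts) :
    ∃ v ∈ M, (δ : ℂ) * hexCenter d.fst ∈ closedBall (triMeshPoint δ v) δ ∧
      (δ : ℂ) * hexCenter d.snd ∈ closedBall (triMeshPoint δ v) δ ∧
      ‖hexCenter d.fst - triEmbed v‖ ≤ 1 ∧ ‖hexCenter d.snd - triEmbed v‖ ≤ 1 := by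
  obtain ⟨e, he, hopen, -⟩ := hw.2 d hd
  have h1 : (triEdgeFaces e).1 = d.snd := congrArg Prod.fst he
  have h2 : (triEdgeFaces e).2 = d.fst := congrArg Prod.snd he
  obtain ⟨hb1, hb2⟩ := hexCenter_triEdgeFaces_mem_closedBall hδ e
  obtain ⟨hn1, hn2⟩ := norm_hexCenter_triEdgeFaces_sub_le_one e
  rw [h1] at hb1 hn1
  rw [h2] at hb2 hn2
  exact ⟨e.fst, hopen.2, hb2, hb1, hn2, hn1⟩

/-- Every vertex of a cycle is an endpoint of one of its darts (a cycle has at least three darts).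
[folklore] -/
theorem exists_dart_of_mem_support_of_isCycle {V : Type*} {G : SimpleGraph V} {u : V} {w : G.Walk u u}
    (hw : w.IsCycle) {z : V} (hz : z ∈ w.support) : ∃ d ∈ w.darts, z = d.fst ∨ z = d.snd := by
  have hlen : 2 ≤ w.support.length := by
    rw [SimpleGraph.Walk.length_support]; have := hw.three_le_length; omega
  obtain ⟨p, hp, hzp⟩ := exists_mem_zip_of_mem w.support hlen hz
  obtain ⟨d, hd, h1, h2⟩ := w.exists_dart_of_mem_zip_support hp
  exact ⟨d, hd, by rwa [h1, h2]⟩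

/-- **The polygon of an interface loop of `ω ∩ M_δ(Ω)` lies within `δ` of a disc containing `Ω`.**
[cite: CamiaNewman2006, §4] -/
theorem IsSiteInterfaceLoop.range_hexLoopCurve_subset {ω : Set (Site 2)} {Ω : Set ℂ} {f₀ : HexVertex}
    {w : hexGraph.Walk f₀ f₀} {δ : ℝ} (hw : IsSiteInterfaceLoop (ω ∩ triMeshVertices Ω δ) w) (hδ : 0 ≤ δ)
    {r : ℝ} (hr : Ω ⊆ closedBall (0 : ℂ) r) :
    (hexLoopCurve δ w).range ⊆ closedBall 0 (r + δ) := by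
  set emb : HexVertex → ℂ := fun F ↦ (δ : ℂ) * hexCenter F with hemb
  have hpt : ∀ F ∈ w.support, emb F ∈ closedBall (0 : ℂ) (r + δ) := by
    intro F hF
    obtain ⟨d, hd, hFd⟩ := exists_dart_of_mem_support_of_isCycle hw.isCycle hF
    obtain ⟨v, hv, hf, hg, -, -⟩ := hw.exists_near_of_mem_darts hδ hd
    have hvr : triMeshPoint δ v ∈ closedBall (0 : ℂ) r := hr (mem_triMeshVertices_iff.1 hv)
    have hF' : emb F ∈ closedBall (triMeshPoint δ v) δ := by
      rcases hFd with rfl | rfl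
      exacts [hf, hg]
    rw [mem_closedBall] at hvr hF' ⊢
    linarith [dist_triangle (emb F) (triMeshPoint δ v) 0]
  obtain ⟨l, hl⟩ : ∃ l, w.support = f₀ :: l := ⟨w.support.tail, w.cons_tail_support.symm⟩
  change Set.range (polyline (w.support.map emb)) ⊆ _
  rw [hl, List.map_cons]
  change Set.range (polylineFrom (emb f₀) (l.map emb)).2 ⊆ _
  refine range_polylineFrom_subset (convex_closedBall 0 _) (hpt f₀ (by rw [hl]; simp)) ?_
  intro p hp
  obtain ⟨F, hF, rfl⟩ := List.mem_map.1 hp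
  exact hpt F (by rw [hl]; exact List.mem_cons_of_mem _ hF)

/-- **(H0) for interface loops**: at mesh `δ ∈ (0, 1]`, no interface loop of `ω ∩ M` traverses a
shell `D(x; ρ, R)` with `ρ ≤ δ`, `ρ < R`, more than a fixed number of times (the darts meeting
`B̄(x, ρ)` have both cells in the box of half-width `14` about a site within `2δ` of `x`).
[cite: AizenmanBurchardDuke1999, §1.a] -/
theorem IsSiteInterfaceLoop.not_hasTraversals_of_le {ω M : Set (Site 2)} {f₀ : HexVertex} {w : hexGraph.Walk f₀ f₀}
    (hw : IsSiteInterfaceLoop (ω ∩ M) w) {δ : ℝ} (hδ : 0 < δ) {x : ℂ} {ρ R : ℝ} (hρδ : ρ ≤ δ)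
    (hρR : ρ < R) :
    ¬ (hexLoopCurve δ w).HasTraversals (2 * (((2 * 14 + 1) ^ 2 * 2) ^ 2 + 1) + 1) x ρ R := by
  obtain ⟨c, hc⟩ := exists_site_norm_sub_le x hδ
  rw [← card_hexDartBox c 14]
  refine not_hasTraversals_toCurve_of_isCycle hw.isCycle _ hρR (hexDartBox c 14) fun d hd hmeet ↦ ?_
  obtain ⟨v, -, hf, hg, hnf, hng⟩ := hw.exists_near_of_mem_darts hδ.le hd
  obtain ⟨z, hzseg, hzball⟩ := hmeet
  have hz : z ∈ closedBall (triMeshPoint δ v) δ := (convex_closedBall _ _).segment_subset hf hg hzseg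
  rw [mem_closedBall] at hz hzball
  have hvc : ‖triMeshPoint δ v - triMeshPoint δ c‖ ≤ 4 * δ := by
    have := norm_sub_le (triMeshPoint δ v - x) (triMeshPoint δ c - x)
    rw [sub_sub_sub_cancel_right] at this
    rw [dist_eq_norm] at hz hzball
    have h1 : ‖triMeshPoint δ v - x‖ ≤ 2 * δ := by
      have := norm_sub_le (triMeshPoint δ v - z) (x - z)
      rw [sub_sub_sub_cancel_right] at this
      rw [norm_sub_rev] at hz
      linarith [norm_sub_rev x z]
    linarith
  have hvc' := norm_triEmbed_sub_le_of_triMeshPoint hδ hvc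
  have key : ∀ F : HexVertex, ‖hexCenter F - triEmbed v‖ ≤ 1 → ∀ i, |F.1 i - c i| ≤ (14 : ℕ) := by
    intro F hF i
    refine abs_sub_le_of_norm_hexCenter_sub_le (K := 5) ?_ (by norm_num) i
    have := norm_sub_le (hexCenter F - triEmbed v) (triEmbed c - triEmbed v)
    rw [sub_sub_sub_cancel_right] at this
    linarith [norm_sub_rev (triEmbed c) (triEmbed v)]
  exact mem_hexDartBox (key d.fst hnf) (key d.snd hng)

/-! ### The discharge -/

/-- **`isTightLaws_map_triLoopCollection` holds** (Aizenman–Burchard, Duke Math. J. 99 (1999),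
Thm 1.2 for the system of all interface loops; H1 by RSW + BK, App. A). For every Jordan domain
`D` the laws of `triLoopCollection D δ` under `P_{1/2}`, `δ ∈ (0, 1]`, are tight on `LoopSpace ℂ`:
the set version of the AB criterion (`LoopSpace.isTightLaws_map_of_traversalBounds`) with
`Λ = closedBall 0 r₀ ⊇` all interface polygons, the short-distance cutoff
(`IsSiteInterfaceLoop.not_hasTraversals_of_le`) and the multiple-traversal estimate
(`triSitePercolation_exists_loop_hasTraversals_le`), the loop collection being the closure of the
classes of the interface polygons. [cite: AizenmanBurchardDuke1999, Thm 1.2 and Appendix A] -/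
theorem isTightLaws_map_triLoopCollection_holds : isTightLaws_map_triLoopCollection := by
  intro D
  obtain ⟨r, hr⟩ := D.isBounded.subset_closedBall (0 : ℂ)
  obtain ⟨k₁, K, lam, hK, hlam, hH1⟩ := triSitePercolation_exists_loop_hasTraversals_le
  set k₀ : ℕ := 2 * (((2 * 14 + 1) ^ 2 * 2) ^ 2 + 1) + 1 with hk₀
  set r₀ : ℝ := max r 0 + 1 with hr₀
  have hr₀0 : 0 ≤ r₀ := by positivity
  have hr' : D.carrier ⊆ closedBall (0 : ℂ) (max r 0) := hr.trans (closedBall_subset_closedBall (le_max_left _ _))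
  -- the random sets of interface polygons
  set X : ℝ → SiteConfig (Site 2) → Set (Curve ℂ) := fun δ ω ↦
    {γ | ∃ (f₀ : HexVertex) (w : hexGraph.Walk f₀ f₀),
      IsSiteInterfaceLoop (ω ∩ triMeshVertices D.carrier δ) w ∧ γ = hexLoopCurve δ w} with hX
  refine LoopSpace.isTightLaws_map_of_traversalBounds (E := ℂ) (isCompact_closedBall (0 : ℂ) r₀)
    (C := 9 * (r₀ + 2) ^ 2) (d := 2) zero_le_two
    (fun ρ hρ hρ1 ↦ exists_finset_card_le_cover_closedBall hr₀0 ρ hρ hρ1)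
    (Ω := fun _ ↦ SiteConfig (Site 2)) (fun _ ↦ triSitePercolation half) X
    (fun δ ↦ triLoopCollection D δ) (fun _ _ _ ↦ max k₀ k₁) hK hlam ?_ ?_ ?_
  · -- the loop collection is the closure of the classes of the interface polygons
    intro δ _ ω c hc
    change c ∈ closure {c | ∃ (f : HexVertex) (γ : hexGraph.Walk f f),
      IsSiteInterfaceLoop (ω ∩ triMeshVertices D.carrier δ) γ ∧ c = siteLoopCurve δ γ} at hc
    refine closure_mono ?_ hc
    rintro _ ⟨f, γ, hγ, rfl⟩
    exact ⟨hexLoopCurve δ γ, ⟨f, γ, hγ, rfl⟩, rfl⟩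
  · -- (H0)
    rintro δ ⟨hδ0, hδ1⟩
    refine ae_of_all _ fun ω γ hγ ↦ ?_
    obtain ⟨f, w, hw, rfl⟩ := hγ
    refine ⟨?_, fun x ρ R hρ hρδ hρR htr ↦ ?_⟩
    · exact (hw.range_hexLoopCurve_subset hδ0.le hr').trans (closedBall_subset_closedBall (by rw [hr₀]; linarith))
    · exact hw.not_hasTraversals_of_le hδ0 hρδ hρR (htr.of_le (le_max_left _ _))
  · -- (H1)
    intro δ hδ x ρ R hδρ hρR hR1
    refine le_trans (measure_mono ?_) (hH1 (triMeshVertices D.carrier δ) δ hδ x ρ R hδρ hρR hR1)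
    rintro ω ⟨γ, ⟨f, w, hw, rfl⟩, htr⟩
    exact ⟨f, w, hw, htr.of_le (le_max_right _ _)⟩

end Literature.Probability.Percolation
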